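import Summits.QuantumFields.BalabanUV.T4Continuum.Spine.NE1p.DressedRootComposition

/-!
# T⁴ programme, spine estimate NE1′ (node O3b/H2) — LIVE REGENERATION AND A LIVE GAUGE QUOTIENT ON THE COMPOSITION FACE OF
# RECORD (decided deterministic toy; swarm row W19 of `t4/formal/NE1p/LEAVES.md`, typer R-T73 (i) ∕ R-T74 (vii) standard;
# INTENT HOME/CLAIMS.log l.13240)

Cell `pub-balaban`, sub-cell `t4`, BINDER-OWNERS row NE1′, NE1′ formalisation crew `b2b-balaban-t4-ne1p-formalise-*`, seat `…-leaf-08`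
(gen 3; lineage S1c-face p213121, S2e–S2h, S8.1 p213858, S3s p217391∕p218354).  ADDITIVE — imports the owner's N0e
`Spine/NE1p/DressedRootComposition` (p217849, the (γ)-route face of record) ONLY; modifies nothing; NO witness row (W1–W18) is
imported or copied — the datum is NEW (booked sizes are sums over LIVE generations; W18's `towerC` has births only).

WHY.  The tower face OF RECORD of row NE1′ (dagwriter Q40) is N0e's `dressedStabilityStrict_of_composition`.  Its one decided
instantiation W18 `DressedCompositionWitness` (p218795) meets the regeneration leaf (w5) `hreg` (N0e l.161–162, `c ≤ c̄` l.153) at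
`c ≡ 0 = c̄` because later generations are ABSENT («(w5) is IDLE on this toy»), and the gauge data `rel`∕`hinv` (N0e l.164∕166) ∕
the `RelGauge` witness of `hlin` (l.175) at `rel := Eq`, witness `rfl`.  Typer R-T73 (i): «a second composition witness is
saturation-barred unless it names binders W18 leaves idle ((w5) `hreg` with `c ≢ 0`, a non-trivial `rel`∕`hinv`)».  This file
decides ONE datum exercising BOTH, at the integer `L = 2`:
* §1 THE DATUM `towerR`: at cutoff `K` one family per birth scale `b ≤ K`, every alive family felt at every later cube; the carried
  function of generation `k′` of family `b` is `U ↦ gR K b k′ · exp U` on the complex line (chart `U + t·d`, window `closedBall 0 1`),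
  GAUGE RELATION `U ∼ U′ :⇔ exp U = exp U′` spelled INLINE (no `def … : Prop`); birth coefficient `(4e³)⁻¹(1/8)^(K−b)` and at EVERY
  later scale a NEW generation — the step `k → k+1` generates EXACTLY `c̄ ×` the transported birth generation, `c̄ = 1/32`
  (`genR_succ`); family size `sizeR = Σ_{k′ ∈ [b,k]} linR` over the live generations (convention (A) with EQUALITY).
* §2 NON-VACUITY in kernel: `genR_succ_pos` (a POSITIVE new generation at every later step), `hreg_ineq_fails_at_zero` (planted
  mutant `c̄ ↦ 0`: the regeneration inequality with constant `0` is FALSE on the datum), `rel_ne_eq` (`0 ∼ 2πi ≠ 0`), and the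
  attained pair of `hlin` is `(0, δ + 2πi)`: NOT a chart move of the base inside the window (`one_lt_norm_attainedPoint`) but
  gauge-equivalent to `move 0 δ 1` (`rel_attainedPoint`) — THE QUOTIENT ACTS on N0e.
* §3 N0e's binders discharged on the datum: `hinv_R` (periodicity), `hsl_R` (a `BirthSlice` of `gR·exp` at EVERY generation and
  scale), `hrate_R` (equality), `hlin_R` (attained THROUGH the quotient, by `δ + 1 ≤ e^δ`), `hbirth_R` (births ON the class),
  **`hreg_R` with `c ≡ c̄ = 1/32`** (`gen b (k+1) = c̄·lin b b k ≤ c̄·size b k`), `hS_R`∕`hcount_R` (`N₀ = 1`).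
* §4 THE END **`dressedStabilityStrict_towerR : DressedStabilityStrict towerR ((2:ℝ) ^ 4)`** = N0e BY NAME, ONE application, at
  `L = 2, a = 1, c_δ = r = w = 1 (C = 4), c̄ = 1/32, N₀ = A₀ = 1, m = 1/4, s̄⁰ = 0, ρ′ = 3/4` — the cell TIGHT twice:
  `locOf 2 1 4 c̄ = 1/2 + 1/4 = 3/4 = ρ′` (the regeneration term of (w7) LIVE, vs W18's `0`), `ρ₁ = rhoOneOf ¼ 1 4 c̄ = 3/8`, strict
  product `16·(3/8)·(1/8) = 3/4`, `m·N₀A₀(1−ρ′)⁻¹ = 1 ≤ 1 − s̄⁰` (`cell_at_two_regen`); headline + ROOT-B by N0e §3.  Λ PIN (referee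
  k4): `(2:ℝ)^4` IS the count rate `(2^4)^(k−j)` of `hcount_R`.

HONEST FRAMING (c4).  «The (γ) face OF RECORD fires on ONE decided deterministic datum at the integer `L = 2` with (w5) LIVE and a
gauge quotient that ACTS; no `e³` of (1.75) (the `e³` here is the sup of `exp` on the toy's slice domain), no `wOp`, no measure, no
margin; nothing of Bałaban's; (VAL-θ)∕(w1)∕(w5)∕(w5b)∕PAY untouched as ESTIMATES — posited toy data here».  [folklore] ∕
[decided toy]; 0 sorry; 0 citations; 0 `def … : Prop` (the `def`s are toy DATA).  Never «NE1′ proved».  NE1′ NOT printed, NOT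
proved; spine PROVED 0∕9.  Rung (B)+1 on ONE finite four-torus — NOT infinite volume, NOT a mass gap, NOT OS on ℝ⁴, NOT Clay.
HONEST DEPENDENCY: continuum YM on T⁴ ⇐ BetaPertH ∧ nine spine estimates (0/9 proved); BetaPertH ⇐ (D1) ∧ (D4) ∧ CAP+tail;
G-an2-4 gates asym, D1 and NE2/3/4.
-/

noncomputable section

namespace Summit.QuantumFields.BalabanUV.T4Continuum.NE1p.DressedCompositionWitnessRegen

open Finset Metric
open scoped BigOperators
open Literature.MathematicalPhysics.QuantumFieldTheory.Balaban1983to89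
open Literature.MathematicalPhysics.QuantumFieldTheory.Balaban1983to89.T4TermFormat
open Literature.MathematicalPhysics.QuantumFieldTheory.Balaban1983to89.T4TermFormat.Booking
open Literature.MathematicalPhysics.QuantumFieldTheory.Balaban1983to89.T4TrajectoryComparison
open Literature.MathematicalPhysics.QuantumFieldTheory.Balaban1983to89.T4BirthChartTransport (GaugeInvariant BirthSlice RelGauge)
open Summit.QuantumFields.BalabanUV.T4Continuum.T4TrajectoryDensityDressed
open Summit.QuantumFields.BalabanUV.T4Continuum.NE1p.DressedRoot
open Summit.QuantumFields.BalabanUV.T4Continuum.NE1p.DressedUniformConstants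
open Summit.QuantumFields.BalabanUV.T4Continuum.NE1p.DressedRootComposition

/-! ## §1 The datum: one family per scale, live generations at every later scale, `exp`-carried functions -/

/-- THE REGENERATION CONSTANT of the toy: `c̄ = 1/32` (`C·c̄ = 1/8` enters the family factor and (w7)) [decided toy]. [folklore] -/
def cbarR : ℝ := 1 / 32

/-- `c̄ > 0`. [folklore] -/
theorem cbarR_pos : 0 < cbarR := by unfold cbarR; norm_num
/-- BIRTH COEFFICIENT of the family born at `b` (cutoff `K`): `(4e³)⁻¹·(1/8)^(K−b)` (`e³` = sup of `‖exp‖` on the slice domain;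
`1/8 = τ = L⁻³`) [decided toy]. [folklore] -/
def g0R (K b : ℕ) : ℝ := (Real.exp 3)⁻¹ / 4 * (1 / 8 : ℝ) ^ (K - b)

/-- Birth coefficients are positive. [folklore] -/
theorem g0R_pos (K b : ℕ) : 0 < g0R K b := by
  unfold g0R; have h : 0 < Real.exp 3 := Real.exp_pos 3; positivity

/-- COEFFICIENT of generation `k′` of the family born at `b`: the birth generation carries `g0R K b`; EVERY later scale `k′ > b`
carries a NEW generation `c̄·e⁻³·g0R K b·(1/4)^(k′−1−b)`; nothing before the birth [decided toy]. [folklore] -/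
def gR (K b k' : ℕ) : ℝ :=
  if k' = b then g0R K b
  else if b < k' then cbarR * (Real.exp 3)⁻¹ * (g0R K b * (1 / 4 : ℝ) ^ (k' - 1 - b)) else 0

/-- Coefficients are nonnegative. [folklore] -/
theorem gR_nonneg (K b k' : ℕ) : 0 ≤ gR K b k' := by
  unfold gR; have := Real.exp_pos 3; have := (g0R_pos K b).le; have := cbarR_pos.le; split_ifs <;> positivity

/-- The birth coefficient. [folklore] -/
theorem gR_birth (K b : ℕ) : gR K b b = g0R K b := by unfold gR; rw [if_pos rfl]

/-- The coefficient generated by the step `k → k+1` (`b ≤ k`). [folklore] -/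
theorem gR_succ (K : ℕ) {b k : ℕ} (hbk : b ≤ k) :
    gR K b (k + 1) = cbarR * (Real.exp 3)⁻¹ * (g0R K b * (1 / 4 : ℝ) ^ (k - b)) := by
  unfold gR; rw [if_neg (by omega), if_pos (by omega), Nat.add_sub_cancel]

/-- Every generation from the birth on is LIVE: `gR K b k′ > 0` for `k′ ≥ b`. [folklore] -/
theorem gR_pos (K : ℕ) {b k' : ℕ} (hbk : b ≤ k') : 0 < gR K b k' := by
  unfold gR; have := Real.exp_pos 3; have := g0R_pos K b; have := cbarR_pos
  by_cases h : k' = b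
  · rw [if_pos h]; exact g0R_pos K b
  · rw [if_neg h, if_pos (by omega)]; positivity

/-- FRESH-PAIR DEFECT of generation `k′` at scale `k`: `(1/4)^(k−k′)` (`c_δ = 1`, rate `(2²)⁻¹`) [decided toy]. [folklore] -/
def defR (k' k : ℕ) : ℝ := (1 / 4 : ℝ) ^ (k - k')

/-- Defects are positive. [folklore] -/
theorem defR_pos (k' k : ℕ) : 0 < defR k' k := by unfold defR; positivity
/-- BOOKED SIZE at scale `k` of generation `k′` of family `b`: coefficient × scale-`k` defect [decided toy]. [folklore] -/
def linR (K b k' k : ℕ) : ℝ := gR K b k' * defR k' k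

/-- Booked generation sizes are nonnegative. [folklore] -/
theorem linR_nonneg (K b k' k : ℕ) : 0 ≤ linR K b k' k := mul_nonneg (gR_nonneg K b k') (defR_pos k' k).le

/-- BOOKED FAMILY SIZE at scale `k`: the SUM over its live generations `k′ ∈ [b, k]` (convention (A), equality). [folklore] -/
def sizeR (K b k : ℕ) : ℝ := ∑ k' ∈ Icc b k, linR K b k' k

/-- Family sizes are nonnegative. [folklore] -/
theorem sizeR_nonneg (K b k : ℕ) : 0 ≤ sizeR K b k := Finset.sum_nonneg fun k' _ => linR_nonneg K b k' k

/-- The transported birth generation is one (nonnegative) term of the family size. [folklore] -/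
theorem linR_birth_le_sizeR (K : ℕ) {b k : ℕ} (hbk : b ≤ k) : linR K b b k ≤ sizeR K b k :=
  Finset.single_le_sum (f := fun k' => linR K b k' k) (fun k' _ => linR_nonneg K b k' k) (Finset.mem_Icc.mpr ⟨le_rfl, hbk⟩)

/-- GENERATION (sup) SIZES: `e³ ×` the coefficient [decided toy]. [folklore] -/
def genR (K b k' : ℕ) : ℝ := Real.exp 3 * gR K b k'

/-- Generation sizes are nonnegative. [folklore] -/
theorem genR_nonneg (K b k' : ℕ) : 0 ≤ genR K b k' := mul_nonneg (Real.exp_pos 3).le (gR_nonneg K b k')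

/-- **LIVE REGENERATION, EXACTLY**: the step `k → k+1` generates `c̄ ×` the transported birth generation —
`genR K b (k+1) = c̄ · linR K b b k` (`b ≤ k`). [folklore] -/
theorem genR_succ (K : ℕ) {b k : ℕ} (hbk : b ≤ k) : genR K b (k + 1) = cbarR * linR K b b k := by
  unfold genR linR defR
  rw [gR_succ K hbk, gR_birth]
  field_simp [(Real.exp_pos 3).ne']

/-- THE BOOKING at cutoff `K` [decided toy]: births ∕ cubes `Fin (K+1)` (one per scale), every alive family felt at every later cube,
family sizes `sizeR`; domains, tree lengths, pair strengths trivial.  Nothing of Bałaban's is modelled. [folklore] -/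
def BR (K : ℕ) : T4TermFormat.Booking where
  K := K
  Dom := Fin (K + 1)
  domScale := fun X => X.val
  treeLen := fun _ => 0
  treeLen_nonneg := fun _ => le_rfl
  balSize := fun _ => 0
  Birth := Fin (K + 1)
  births := Finset.univ
  mem_births := fun b => Finset.mem_univ b
  birthScale := fun b => b.val
  birth_le := fun b => Nat.lt_succ_iff.mp b.isLt
  loc := fun b => b
  loc_scale := fun _ => rfl
  Cube := Fin (K + 1)
  cubes := Finset.univ
  mem_cubes := fun q => Finset.mem_univ q
  cubeScale := fun q => q.val
  cube_le := fun q => Nat.lt_succ_iff.mp q.isLt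
  feltAt := fun q => Finset.univ.filter fun b : Fin (K + 1) => b.val ≤ q.val
  felt_birth_le := fun _ _ hb => (Finset.mem_filter.mp hb).2
  size := fun b k => sizeR K b.val k
  size_nonneg := fun b k => sizeR_nonneg K b.val k
  pair := fun _ _ _ => 0

/-- THE TRAJECTORY at cutoff `K` [decided toy]: a generation at EVERY scale `k′ ∈ [b, K]` of every family; convention (A) holds with
EQUALITY by construction of `sizeR`. [folklore] -/
def TR (K : ℕ) : Trajectory (BR K) where
  lin := fun b k' k => linR K b.val k' k
  lin_nonneg := fun b k' k => linR_nonneg K b.val k' k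
  gen := fun b k' => genR K b.val k'
  gen_nonneg := fun b k' => genR_nonneg K b.val k'
  size_le := fun _ _ _ _ => le_rfl

/-- THE TOWER [decided toy]: the datum at every cutoff (one run parameter). [folklore] -/
def towerR : DressedTower Unit where
  B := fun _ K => BR K
  K_eq := fun _ _ => rfl
  T := fun _ K => TR K

/-- THE CARRIED FUNCTION of generation `k′` of family `b` at every scale: `U ↦ gR K b k′ · exp U` [decided toy]. [folklore] -/
def FnR (K : ℕ) (b : Fin (K + 1)) (k' : ℕ) (_k : ℕ) (U : ℂ) : ℂ := (gR K b.val k' : ℂ) * Complex.exp U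

/-- THE LIVE FAMILIES of any met component at step `k` [decided toy]: every family born at a scale `≤ k`. [folklore] -/
def SR (K k : ℕ) (_b : Fin (K + 1)) : Finset (Fin (K + 1)) := Finset.univ.filter fun f : Fin (K + 1) => f.val ≤ k

/-- The point ATTAINING the booked size against the base `U₀ = 0`: `δ + 2πi` [decided toy]. [folklore] -/
def attainedPoint (k' k : ℕ) : ℂ := (defR k' k : ℂ) + 2 * Real.pi * Complex.I

/-! ## §2 Non-vacuity, decided: regeneration is live, the relation is not equality, the attained pair is not a move -/

/-- **REGENERATION IS LIVE**: every family generates a POSITIVE new generation at every later step. [folklore] -/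
theorem genR_succ_pos (K : ℕ) {b k : ℕ} (hbk : b ≤ k) : 0 < genR K b (k + 1) := mul_pos (Real.exp_pos 3) (gR_pos K (by omega))

/-- **THE PLANTED MUTANT `c̄ ↦ 0`, IN KERNEL**: the regeneration inequality `gen b (k+1) ≤ c·size b k` of (w5) with `c = 0` is
FALSE on the datum (family born at `0`, first step, any `K ≥ 1`; gate-free form — the gated leaf is `hreg_R`). [folklore] -/
theorem hreg_ineq_fails_at_zero (K : ℕ) (hK : 1 ≤ K) :
    ¬ ∀ b k : ℕ, b ≤ k → k < K → genR K b (k + 1) ≤ 0 * sizeR K b k := fun h =>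
  absurd ((h 0 0 le_rfl (by omega)).trans_eq (zero_mul _)) (not_le.mpr (genR_succ_pos K le_rfl))

/-- **THE RELATION IS NOT EQUALITY**: the toy's gauge relation `U ∼ U′ :⇔ exp U = exp U′` relates `0 ∼ 2πi`, and `0 ≠ 2πi`.
[folklore] -/
theorem rel_ne_eq : ∃ U U' : ℂ, (fun U U' : ℂ => Complex.exp U = Complex.exp U') U U' ∧ U ≠ U' := by
  refine ⟨0, 2 * Real.pi * Complex.I, ?_, fun h => ?_⟩
  · show Complex.exp 0 = Complex.exp (2 * Real.pi * Complex.I)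
    rw [Complex.exp_zero, Complex.exp_two_pi_mul_I]
  · have him := congrArg Complex.im h
    simp at him

/-- **THE QUOTIENT ACTS**: the attained point is gauge-equivalent to the chart move `move 0 δ 1 = 0 + 1·δ` of the base … [folklore] -/
theorem rel_attainedPoint (k' k : ℕ) :
    (fun U U' : ℂ => Complex.exp U = Complex.exp U') (attainedPoint k' k) (0 + 1 * (defR k' k : ℂ)) := by
  show Complex.exp (attainedPoint k' k) = Complex.exp (0 + 1 * (defR k' k : ℂ))
  unfold attainedPoint
  rw [Complex.exp_add, Complex.exp_two_pi_mul_I, mul_one, zero_add, one_mul]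

/-- … but is NOT itself a move of the base inside the window: `‖attainedPoint − 0‖ > 1 ≥ δ` (imaginary part `2π`). [folklore] -/
theorem one_lt_norm_attainedPoint (k' k : ℕ) : 1 < ‖attainedPoint k' k - 0‖ := by
  have him : (attainedPoint k' k).im = 2 * Real.pi := by unfold attainedPoint; simp
  have h := Complex.abs_im_le_norm (attainedPoint k' k)
  rw [him] at h; rw [sub_zero]; linarith [Real.pi_gt_three, le_abs_self (2 * Real.pi)]

/-! ## §3 The binders of the composition face, discharged on the datum -/

/-- `hinv` GENUINELY: the carried functions are invariant under the periodicity relation (they factor through `exp`). [folklore] -/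
theorem hinv_R (K : ℕ) (b : (BR K).Birth) (k' k : ℕ) :
    GaugeInvariant (fun U U' : ℂ => Complex.exp U = Complex.exp U') (FnR K b k' k) := by
  intro U U' h
  unfold FnR
  rw [show Complex.exp U = Complex.exp U' from h]

/-- A point of the slice domain has norm `≤ 3`: `‖U‖ ≤ 1`, `‖t‖ ≤ 1 + 1/‖d‖`, `0 < ‖d‖ ≤ 1`. [folklore] -/
theorem norm_slicePoint_le {U t d : ℂ} (hU : U ∈ closedBall (0 : ℂ) 1) (hd : 0 < ‖d‖) (hdw : ‖d‖ ≤ 1)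
    (ht : t ∈ closedBall (0 : ℂ) (1 + 1 / ‖d‖)) : ‖U + t * d‖ ≤ 3 := by
  have htd : ‖t‖ * ‖d‖ ≤ (1 + 1 / ‖d‖) * ‖d‖ :=
    mul_le_mul_of_nonneg_right (mem_closedBall_zero_iff.mp ht) (norm_nonneg d)
  rw [add_mul, one_mul, one_div, inv_mul_cancel₀ hd.ne'] at htd
  calc ‖U + t * d‖ ≤ ‖U‖ + ‖t‖ * ‖d‖ := (norm_add_le _ _).trans (by rw [norm_mul])
    _ ≤ 1 + (‖d‖ + 1) := add_le_add (mem_closedBall_zero_iff.mp hU) htd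
    _ ≤ 3 := by linarith

/-- (F-1′ ∕ (VAL-θ)-lite slot) `hsl` NON-VACUOUSLY at EVERY generation and scale: `gR·exp` has a `BirthSlice` along the affine chart,
window `1`, radius `1`, regular set `closedBall 0 1`, with sup `1^(k−k′)·gen = e³·gR` on the slice domain `closedBall 0 (1 + 1/‖d‖)`
(where `‖U + t·d‖ ≤ 3`, so `‖exp‖ ≤ e³`). [folklore] -/
theorem hsl_R (K : ℕ) : ∀ (b : (BR K).Birth) (k' k : ℕ), (BR K).birthScale b ≤ k' → k' ≤ k → k ≤ (BR K).K →
    RanBelow (budgetGate (TR K) (fun _ _ => (0 : ℝ)) (1 / 4) (SR K) (4 * 1 / 1) (fun _ : ℕ => ((2 : ℝ) ^ 2)⁻¹ * 1)) k →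
    BirthSlice (FnR K b k' k) (fun U d t => U + t * d) (fun d : ℂ => ‖d‖) (closedBall (0 : ℂ) 1) 1 1
      ((1 : ℝ) ^ (k - k') * (TR K).gen b k') := by
  intro b k' k _ _ _ _ U hU d hd hdw
  rw [one_pow, one_mul]
  show ∃ Dm : Set ℂ, DifferentiableOn ℂ (fun t : ℂ => FnR K b k' k (U + t * d)) Dm ∧
      (∀ t ∈ Dm, ‖FnR K b k' k (U + t * d)‖ ≤ genR K b.val k') ∧
      ∀ s ∈ Set.Icc (0 : ℝ) 1, closedBall (s : ℂ) (1 / ‖d‖) ⊆ Dm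
  refine ⟨closedBall (0 : ℂ) (1 + 1 / ‖d‖), ?_, ?_, ?_⟩
  · unfold FnR
    exact ((differentiable_const _).mul (Complex.differentiable_exp.comp
      ((differentiable_const _).add (differentiable_id.mul (differentiable_const _))))).differentiableOn
  · intro t ht
    unfold FnR genR
    rw [norm_mul, Complex.norm_real, Real.norm_of_nonneg (gR_nonneg K b.val k'), Complex.norm_exp, mul_comm]
    refine mul_le_mul_of_nonneg_right ?_ (gR_nonneg K b.val k')
    exact Real.exp_le_exp.mpr ((Complex.re_le_norm _).trans (norm_slicePoint_le hU hd hdw ht))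
  · intro s hs t ht
    rw [mem_closedBall, dist_eq_norm] at ht
    have h2 : ‖(s : ℂ)‖ ≤ 1 := by rw [Complex.norm_real, Real.norm_of_nonneg hs.1]; exact hs.2
    rw [mem_closedBall_zero_iff]
    calc ‖t‖ = ‖t - (s : ℂ) + (s : ℂ)‖ := by rw [sub_add_cancel]
      _ ≤ ‖t - (s : ℂ)‖ + ‖(s : ℂ)‖ := norm_add_le _ _
      _ ≤ 1 + 1 / ‖d‖ := by linarith

/-- (F-6′ ∕ (VAL-θ) slot) `hrate` with EQUALITY: the defect is `c_δ·((L²)⁻¹)^(k−k′)` at `c_δ = 1`, `L = 2`. [folklore] -/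
theorem hrate_R (K : ℕ) : ∀ (b : (BR K).Birth) (k' k : ℕ), (BR K).birthScale b ≤ k' → k' ≤ k → k ≤ (BR K).K →
    defR k' k ≤ 1 * (((2 : ℝ) ^ 2)⁻¹) ^ (k - k') := by
  intro b k' k _ _ _; unfold defR; norm_num

/-- `hdefw`: every defect is inside the window `1`. [folklore] -/
theorem hdefw_R (k' k : ℕ) : defR k' k ≤ 1 := by unfold defR; exact pow_le_one₀ (by norm_num) (by norm_num)

/-- The response to the attained pair: `‖gR·exp(δ + 2πi) − gR·exp 0‖ = gR·(e^δ − 1)`. [folklore] -/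
theorem norm_response_attainedPoint (K : ℕ) (b : Fin (K + 1)) (k' k : ℕ) :
    ‖FnR K b k' k (attainedPoint k' k) - FnR K b k' k 0‖ = gR K b.val k' * (Real.exp (defR k' k) - 1) := by
  unfold FnR attainedPoint
  rw [Complex.exp_add, Complex.exp_two_pi_mul_I, mul_one, Complex.exp_zero, ← Complex.ofReal_exp, ← mul_sub,
    ← Complex.ofReal_one, ← Complex.ofReal_sub, ← Complex.ofReal_mul, Complex.norm_real, Real.norm_of_nonneg]
  exact mul_nonneg (gR_nonneg K b.val k') (by linarith [Real.add_one_le_exp (defR k' k), (defR_pos k' k).le])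

/-- (F-8) `hlin` ATTAINED THROUGH THE QUOTIENT: the booked size `gR·δ` of generation `(b, k′)` at scale `k` is realised by the pair
`U₀ = 0`, `U₁ = δ + 2πi` — gauge-equivalent to the move `0 + 1·δ` (`RelGauge` with the direction `d = δ` of norm exactly the defect)
though not itself inside the window — since `gR·δ ≤ gR·(e^δ − 1)`. [folklore] -/
theorem hlin_R (K : ℕ) : ∀ (b : (BR K).Birth) (k' k : ℕ), (BR K).birthScale b ≤ k' → k' ≤ k → k ≤ (BR K).K →
    RanBelow (budgetGate (TR K) (fun _ _ => (0 : ℝ)) (1 / 4) (SR K) (4 * 1 / 1) (fun _ : ℕ => ((2 : ℝ) ^ 2)⁻¹ * 1)) k →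
    ∀ ε > 0, ∃ U₀ ∈ closedBall (0 : ℂ) 1, ∃ U₁ : ℂ,
      RelGauge (fun U U' : ℂ => Complex.exp U = Complex.exp U') (fun U d t => U + t * d) (fun d : ℂ => ‖d‖) U₀ U₁
        (defR k' k) ∧
        (TR K).lin b k' k ≤ ‖FnR K b k' k U₁ - FnR K b k' k U₀‖ + ε := by
  intro b k' k _ _ _ _ ε hε
  have hnorm : ‖(defR k' k : ℂ)‖ = defR k' k := by rw [Complex.norm_real, Real.norm_of_nonneg (defR_pos k' k).le]
  refine ⟨0, mem_closedBall_self zero_le_one, attainedPoint k' k,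
    ⟨(defR k' k : ℂ), by show 0 < ‖(defR k' k : ℂ)‖; rw [hnorm]; exact defR_pos k' k,
      by show ‖(defR k' k : ℂ)‖ ≤ defR k' k; rw [hnorm], rel_attainedPoint k' k⟩, ?_⟩
  show linR K b.val k' k ≤ ‖FnR K b k' k (attainedPoint k' k) - FnR K b k' k 0‖ + ε
  rw [norm_response_attainedPoint]
  unfold linR
  have h := mul_le_mul_of_nonneg_left (show defR k' k ≤ Real.exp (defR k' k) - 1 by
    linarith [Real.add_one_le_exp (defR k' k)]) (gR_nonneg K b.val k')
  linarith

/-- (w1)+(w5b) `hbirth` with EQUALITY at every birth scale: `C·gen b b = 4·e³·(4e³)⁻¹(1/8)^(K−b) = twoRate 1 ρ₁ (1/8) K b b`.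
[folklore] -/
theorem hbirth_R (K : ℕ) : (TR K).BirthsFromOld (4 * 1 / 1) (fun _ : ℕ => ((2 : ℝ) ^ 2)⁻¹ * 1)
    (twoRate 1 (rhoOneOf ((2 : ℝ) ^ 2)⁻¹ 1 (4 * 1 / 1) cbarR) ((2 : ℝ)⁻¹ ^ 3) (BR K).K)
    (budgetGate (TR K) (fun _ _ => (0 : ℝ)) (1 / 4) (SR K) (4 * 1 / 1) (fun _ : ℕ => ((2 : ℝ) ^ 2)⁻¹ * 1)) := by
  intro b _ _ _
  show 4 * 1 / 1 * genR K b.val b.val ≤ twoRate 1 (rhoOneOf ((2 : ℝ) ^ 2)⁻¹ 1 (4 * 1 / 1) cbarR) ((2 : ℝ)⁻¹ ^ 3) K b.val b.val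
  unfold genR twoRate
  rw [gR_birth, Nat.sub_self, pow_zero, mul_one, one_mul]
  unfold g0R
  rw [le_iff_eq_or_lt]; left
  field_simp [(Real.exp_pos 3).ne']
  norm_num

/-- (w5) `hreg` WITH THE LIVE CONSTANT `c ≡ c̄ = 1/32`: the step `k → k+1` generates exactly `c̄ ×` the transported birth generation,
one nonnegative term of the family's booked size — `gen b (k+1) = c̄·lin b b k ≤ c̄·size b k`.  FALSE with `c = 0`
(`hreg_ineq_fails_at_zero`). [folklore] -/
theorem hreg_R (K : ℕ) : (TR K).RegeneratesFromVar (fun _ : ℕ => cbarR)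
    (budgetGate (TR K) (fun _ _ => (0 : ℝ)) (1 / 4) (SR K) (4 * 1 / 1) (fun _ : ℕ => ((2 : ℝ) ^ 2)⁻¹ * 1)) := by
  intro b k hbk _ _
  change b.val ≤ k at hbk
  show genR K b.val (k + 1) ≤ cbarR * sizeR K b.val k
  rw [genR_succ K hbk]
  exact mul_le_mul_of_nonneg_left (linR_birth_le_sizeR K hbk) cbarR_pos.le

/-- (w3-book) `hS`: live families are born. [folklore] -/
theorem hS_R (K : ℕ) : ∀ k (b : (BR K).Birth), ∀ f ∈ SR K k b, (BR K).birthScale f ≤ k :=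
  fun _ _ _ hf => (Finset.mem_filter.mp hf).2

/-- At most ONE family has a given birth scale: any scale-`j` fibre of families is counted by `1 ≤ 1·(L⁴)^n`. [folklore] -/
theorem card_fibre_le (K : ℕ) (s : Finset (Fin (K + 1))) (j n : ℕ) :
    (((s.filter fun f => (BR K).birthScale f = j).card : ℝ)) ≤ 1 * ((2 : ℝ) ^ 4) ^ n := by
  have h1 : (s.filter fun f => (BR K).birthScale f = j).card ≤ 1 :=
    Finset.card_le_one.mpr fun f hf f' hf' =>
      Fin.ext (((Finset.mem_filter.mp hf).2 : f.val = j).trans ((Finset.mem_filter.mp hf').2 : f'.val = j).symm)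
  have h2 : (1 : ℝ) ≤ 1 * ((2 : ℝ) ^ 4) ^ n := by rw [one_mul]; exact one_le_pow₀ (by norm_num)
  exact le_trans (by exact_mod_cast h1) h2

/-- (w3-book) `hcount`: the live set of a step-`k` component has ONE member per birth scale `j ≤ k` — `≤ 1·(L⁴)^(k−j)`. [folklore] -/
theorem hcount_R (K : ℕ) : ∀ k (b : (BR K).Birth), ∀ j ≤ k,
    ((((SR K k b).filter fun f => (BR K).birthScale f = j).card : ℝ)) ≤ 1 * ((2 : ℝ) ^ 4) ^ (k - j) :=
  fun k b j _ => card_fibre_le K (SR K k b) j (k - j)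

/-- The bookings' POSITIONAL COUNT at rate `L⁴ = 16`, multiplicity `N₀ = 1` (for ROOT-B). [folklore] -/
theorem positionalCount_R (K : ℕ) : (BR K).PositionalCount fun j k => 1 * ((2 : ℝ) ^ 4) ^ (k - j) :=
  fun q j => card_fibre_le K ((BR K).feltAt q) j ((BR K).cubeScale q - j)

/-! ## §4 The END: the composition face of record fires at `L = 2` with live regeneration -/

/-- **THE CELL AT `L = 2` WITH LIVE REGENERATION, DECIDED** [toy numerals]: `locOf 2 1 4 c̄ = 3/4` (TIGHT against `ρ′ = 3/4`),
N0e's `one_lt_of_composition_cell` gives `1 < 2 ∧ 2·4·c̄ < 1` (the regeneration term of (w7) LIVE), `ρ₁ = 3/8`, strict product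
`16·(3/8)·(1/8) = 3/4`, (w6) window `(1/4)·(1·1·(1 − 3/4)⁻¹) = 1 ≤ 1 − 0` TIGHT. [folklore] -/
theorem cell_at_two_regen :
    locOf 2 1 (4 * 1 / 1) cbarR = 3 / 4 ∧ ((1 : ℝ) < 2 ∧ (2 : ℝ) * (4 * 1 / 1) * cbarR < 1) ∧
      rhoOneOf ((2 : ℝ) ^ 2)⁻¹ 1 (4 * 1 / 1) cbarR = 3 / 8 ∧
      (2 : ℝ) ^ 4 * rhoOneOf ((2 : ℝ) ^ 2)⁻¹ 1 (4 * 1 / 1) cbarR * (2 : ℝ)⁻¹ ^ 3 = 3 / 4 ∧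
      (1 / 4 : ℝ) * (1 * 1 * (1 - 3 / 4)⁻¹) ≤ 1 - 0 := by
  refine ⟨by unfold locOf cbarR; norm_num, ?_, by unfold rhoOneOf cbarR; norm_num,
    by unfold rhoOneOf cbarR; norm_num, by norm_num⟩
  exact one_lt_of_composition_cell (ρ' := 3 / 4) (by norm_num) (by norm_num) cbarR_pos.le
    (by unfold locOf cbarR; norm_num) (by norm_num)

/-- **THE COMPOSITION FACE OF RECORD FIRES AT THE INTEGER `L = 2` WITH (w5) LIVE AND A GAUGE QUOTIENT THAT ACTS — ROOT-C OF RECORD ON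
THE DATUM** [decided toy]: `DressedStabilityStrict towerR ((2:ℝ)^4)` = `DressedRootComposition.dressedStabilityStrict_of_composition`
BY NAME, ONE application, at `L = 2, a = 1, c_δ = r = w = 1, c̄ = 1/32, N₀ = A₀ = 1, m = 1/4, s̄⁰ = 0, ρ′ = 3/4`, every binder
discharged by §3 (`hsl_R`, `hrate_R`, `hlin_R` through the quotient, `hbirth_R`, `hreg_R` with `c ≡ c̄`) NON-VACUOUSLY.  Λ PIN:
`Λ = L^4 = 16` = the count rate of `hcount_R`.  Nothing of Bałaban's. [folklore] -/
theorem dressedStabilityStrict_towerR : DressedStabilityStrict towerR ((2 : ℝ) ^ 4) :=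
  dressedStabilityStrict_of_composition towerR (L := 2) (a := 1) (cδ := 1) (cbar := cbarR) (N₀ := 1) (A₀ := 1) (m := 1 / 4)
    (sbar := 0) (ρ' := 3 / 4) (move := fun U d t : ℂ => U + t * d) (N := fun d : ℂ => ‖d‖) (w := 1) (r := 1)
    (by norm_num) zero_le_one zero_le_one one_pos cbarR_pos.le zero_le_one zero_le_one (by norm_num)
    (by unfold locOf cbarR; norm_num) (by norm_num) (by norm_num)
    (fun _ _ _ => cbarR) (fun _ _ _ _ => 0) (fun _ K => SR K)
    (fun _ _ _ => cbarR_pos.le) (fun _ _ _ _ => le_rfl) (fun _ K => hS_R K) (fun _ K => hcount_R K) (fun _ _ _ _ => le_rfl)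
    (fun _ K => hbirth_R K) (fun _ K => hreg_R K)
    (fun _ K => FnR K) (fun _ _ _ _ => fun U U' : ℂ => Complex.exp U = Complex.exp U')
    (fun _ _ _ _ => closedBall (0 : ℂ) 1) (fun _ _ _ k' k => defR k' k)
    (fun _ K => hinv_R K) (fun _ K => hsl_R K) (fun U d => by simp) (fun _ _ _ k' k => hdefw_R k' k)
    (fun _ K => hrate_R K) (fun _ K => hlin_R K)

/-- **HEADLINE ON THE DATUM** [decided toy]: `DressedStability towerR` (N0e §3 `dressedStability_of_strict_comp` BY NAME). [folklore] -/
theorem dressedStability_towerR : DressedStability towerR :=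
  dressedStability_of_strict_comp dressedStabilityStrict_towerR

/-- **ROOT-B ON THE DATUM** [decided toy]: `DressedBudget towerR wt` for bounded nonnegative cube weights — N0e §3
`dressedBudget_of_strict_comp` BY NAME with the positional count `1·16^(k−j)`. [folklore] -/
theorem dressedBudget_towerR {wt : Unit → ℕ → ℕ → ℝ} {wbar : ℝ} (hwbar : 0 ≤ wbar)
    (hw0 : ∀ p K, ∀ j ≤ K, 0 ≤ wt p K j) (hwb : ∀ p K, ∀ j ≤ K, wt p K j ≤ wbar) :
    DressedBudget towerR wt :=
  dressedBudget_of_strict_comp (L := 2) (N₀ := 1) dressedStabilityStrict_towerR zero_le_one hwbar hw0 hwb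
    fun _ K => positionalCount_R K

end Summit.QuantumFields.BalabanUV.T4Continuum.NE1p.DressedCompositionWitnessRegen

end
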